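import Summits.ValiantsHypothesis.ValiantsHypothesis.Theorems.BarrierLeverChowThinRowsSubcubePairs

/-!
# Route BarrierLever — item `ChowHitsThinRowPartitionMinors` (stmt-ValiantsHypothesis-20195):
# the PAIR LAYER on down-closed column families — prelims for union-labelled layouts

Helper file (`--supports stmt-ValiantsHypothesis-20195`; cell valiant-natproofs, rung V4, 𝒟-side of
door (c); prover seat val-np-p8 gen 0).  Closes NO item; imports only the helper file
`…ChowThinRowsSubcubePairs` (prover g10; no route file).  Conventions as there: `x_a = X (castAdd h a)`,
`y_c = X (natAdd h c)`, the partition-matrix entry of `f` at `(u, w)` is `coeff (E u w) f`,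
`E u w = Σ_{a∈u} single (castAdd h a) 1 + Σ_{c∈w} single (natAdd h c) 1`; the witness family is the
product of the INDICATOR FORMS `φ_V = 1 + Σ_a κ_a(V) x_a + Σ_{c∈V} y_c`, `V ∈ 𝒟`, and
`t_V = Σ_{U ⊆ V} (-1)^{|U|} |U|! · y^U` is the truncated inverse of `φ⁰_V = 1 + y_V`.

* `yOnly_prod` — a finite product of `y`-only polynomials is `y`-only;
* `coeff_tprod_subset` — a product `∏_{a ∈ S} t_{L a}` of truncated inverses is supported on the
  squarefree monomials `y^Z`, `Z ⊆ ⋃_{a∈S} L a`;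
* `coeff_tprod_signed` — its coefficient at `y^Z` is `(-1)^{|Z|}` times a natural number, `≥ 1` at the
  top `Z = ⋃_{a∈S} L a` (SIGN-DEFINITENESS: all decompositions contribute with the same sign);
* `coeff_xdiag_row` — ROW FORMULA FOR THE `x`-DIAGONAL DESIGN: if `x_a` sits exactly in the form
  `φ_{L a}` (`κ_a(V) = [V = L a]`) for the variables of a thin row `u` (`|u| ≤ 2`, labels in `𝒟`,
  distinct inside `u`), then `coeff (E u W) ∏_𝒟 φ = coeff (E ∅ W) (B⁰ · ∏_{a∈u} t_{L a})` with
  `B⁰ = ∏_𝒟 φ⁰` — the derivative formulas `coeff_single_prod` / `coeff_pair_prod` collapse to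
  leave-one/two-out products, closed by `coeff_leaveOneOut`.

Used by `…ChowThinRowsLabelledPairs` (the union-labelled pair layer).  WHAT THIS IS NOT: bookkeeping;
nothing on items 20195 / 20172 / 19717 themselves, on crux stmt-ValiantsHypothesis-14610, or on `VP`
versus `VNP`.
-/

set_option linter.dupNamespace false

namespace Summit.ValiantsHypothesis.ValiantsHypothesis.Theorems.BarrierLever.ChowSubcube

open Finset MvPolynomial
open Summit.ValiantsHypothesis.ValiantsHypothesis.Theorems.BarrierLever.ChowFactor
  (coeff_partitionExpo_mul_affine coeff_partitionExpo_mul_yOnly totalDegree_affine_le)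
open Summit.ValiantsHypothesis.ValiantsHypothesis.Theorems.BarrierLever.ProductStateSums
  (castAdd_ne_natAdd partitionExpo_apply_castAdd partitionExpo_apply_natAdd)
open Summit.ValiantsHypothesis.ValiantsHypothesis.Theorems.BarrierLever.CorankRepair (partitionExpo_eq_iff)

variable {h : ℕ}

/-! ## 1. Products of truncated inverses: support and sign of the top coefficient -/

/-- A finite product of `y`-only polynomials is `y`-only. -/
theorem yOnly_prod {ι : Type*} (S : Finset ι) (f : ι → MvPolynomial (Fin (h + h)) ℂ)
    (hf : ∀ i ∈ S, ∀ s ∈ (f i).support, ∀ a : Fin h, s (Fin.castAdd h a) = 0) :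
    ∀ s ∈ (∏ i ∈ S, f i).support, ∀ a : Fin h, s (Fin.castAdd h a) = 0 := by
  classical
  induction S using Finset.induction_on with
  | empty =>
    rw [Finset.prod_empty]
    intro s hs a
    have : s = 0 := by simpa using hs
    rw [this]; rfl
  | insert i S hi ih =>
    rw [Finset.prod_insert hi]
    exact yOnly_mul (hf i (Finset.mem_insert_self i S))
      (ih fun i' hi' => hf i' (Finset.mem_insert_of_mem hi'))

/-- **Support of a product of truncated inverses**: `coeff (E ∅ Z) (∏_{a ∈ S} t_{L a}) ≠ 0` forces
`Z ⊆ ⋃_{a ∈ S} L a`. -/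
theorem coeff_tprod_subset (S : Finset (Fin h)) (L : Fin h → Finset (Fin h)) (Z : Finset (Fin h))
    (hZ : coeff (∑ a ∈ (∅ : Finset (Fin h)), Finsupp.single (Fin.castAdd h a) 1 +
        ∑ c ∈ Z, Finsupp.single (Fin.natAdd h c) 1)
        (∏ a ∈ S, ∑ U ∈ (L a).powerset, monomial (∑ a' ∈ (∅ : Finset (Fin h)), Finsupp.single (Fin.castAdd h a') 1 +
          ∑ c ∈ U, Finsupp.single (Fin.natAdd h c) 1) ((-1 : ℂ) ^ U.card * (U.card.factorial : ℂ))) ≠ 0) :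
    Z ⊆ S.biUnion L := by
  classical
  induction S using Finset.induction_on generalizing Z with
  | empty =>
    rw [Finset.prod_empty, coeff_one] at hZ
    by_cases hZ0 : Z = ∅
    · rw [hZ0]; exact Finset.empty_subset _
    · exfalso
      apply hZ
      rw [if_neg]
      intro e
      have e' := (partitionExpo_eq_iff ∅ ∅ ∅ Z).mp (by simpa using e)
      exact hZ0 e'.2.symm
  | insert a S ha ih =>
    rw [Finset.prod_insert ha, mul_comm,
      coeff_partitionExpo_mul_yOnly _ _ (yOnly_tinv (L a)) ∅ Z] at hZ
    obtain ⟨d, hd, hne⟩ := Finset.exists_ne_zero_of_sum_ne_zero hZ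
    rw [Finset.mem_powerset] at hd
    have h1 : coeff (∑ a' ∈ (∅ : Finset (Fin h)), Finsupp.single (Fin.castAdd h a') 1 +
        ∑ c ∈ Z \ d, Finsupp.single (Fin.natAdd h c) 1)
        (∏ a' ∈ S, ∑ U ∈ (L a').powerset, monomial (∑ a'' ∈ (∅ : Finset (Fin h)),
          Finsupp.single (Fin.castAdd h a'') 1 + ∑ c ∈ U, Finsupp.single (Fin.natAdd h c) 1)
          ((-1 : ℂ) ^ U.card * (U.card.factorial : ℂ))) ≠ 0 := fun e => hne (by rw [e, zero_mul])
    have h2 : coeff (∑ a' ∈ (∅ : Finset (Fin h)), Finsupp.single (Fin.castAdd h a') 1 +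
        ∑ c ∈ d, Finsupp.single (Fin.natAdd h c) 1)
        (∑ U ∈ (L a).powerset, monomial (∑ a'' ∈ (∅ : Finset (Fin h)),
          Finsupp.single (Fin.castAdd h a'') 1 + ∑ c ∈ U, Finsupp.single (Fin.natAdd h c) 1)
          ((-1 : ℂ) ^ U.card * (U.card.factorial : ℂ))) ≠ 0 := fun e => hne (by rw [e, mul_zero])
    rw [coeff_tinv] at h2
    have hdL : d ⊆ L a := by
      by_contra hc
      exact h2 (if_neg hc)
    have hZd := ih (Z \ d) h1
    intro x hx
    rw [Finset.biUnion_insert, Finset.mem_union]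
    by_cases hxd : x ∈ d
    · exact Or.inl (hdL hxd)
    · exact Or.inr (hZd (Finset.mem_sdiff.mpr ⟨hx, hxd⟩))

/-- **Sign of the coefficients of a product of truncated inverses**: `coeff (E ∅ Z) (∏_{a∈S} t_{L a})`
is `(-1)^{|Z|}` times a natural number, which is `≥ 1` at the top `Z = ⋃_{a∈S} L a`. -/
theorem coeff_tprod_signed (S : Finset (Fin h)) (L : Fin h → Finset (Fin h)) (Z : Finset (Fin h)) :
    ∃ n : ℕ, coeff (∑ a ∈ (∅ : Finset (Fin h)), Finsupp.single (Fin.castAdd h a) 1 +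
        ∑ c ∈ Z, Finsupp.single (Fin.natAdd h c) 1)
        (∏ a ∈ S, ∑ U ∈ (L a).powerset, monomial (∑ a' ∈ (∅ : Finset (Fin h)), Finsupp.single (Fin.castAdd h a') 1 +
          ∑ c ∈ U, Finsupp.single (Fin.natAdd h c) 1) ((-1 : ℂ) ^ U.card * (U.card.factorial : ℂ))) =
        (-1 : ℂ) ^ Z.card * (n : ℂ) ∧ (Z = S.biUnion L → 1 ≤ n) := by
  classical
  induction S using Finset.induction_on generalizing Z with
  | empty =>
    refine ⟨if Z = ∅ then 1 else 0, ?_, ?_⟩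
    · rw [Finset.prod_empty, coeff_one]
      by_cases hZ0 : Z = ∅
      · subst hZ0; simp
      · have hne : ¬ ((0 : Fin (h + h) →₀ ℕ) = ∑ a ∈ (∅ : Finset (Fin h)), Finsupp.single (Fin.castAdd h a) 1 +
            ∑ c ∈ Z, Finsupp.single (Fin.natAdd h c) 1) := by
          intro e
          have e' := (partitionExpo_eq_iff ∅ ∅ ∅ Z).mp (by simpa using e)
          exact hZ0 e'.2.symm
        rw [if_neg hne, if_neg hZ0]
        simp
    · intro hZ
      rw [Finset.biUnion_empty] at hZ
      simp [hZ]
  | insert a S ha ih =>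
    choose n hn hn1 using ih
    refine ⟨∑ d ∈ Z.powerset, (if d ⊆ L a then d.card.factorial else 0) * n (Z \ d), ?_, ?_⟩
    · rw [Finset.prod_insert ha, mul_comm,
        coeff_partitionExpo_mul_yOnly _ _ (yOnly_tinv (L a)) ∅ Z]
      push_cast
      rw [Finset.mul_sum]
      refine Finset.sum_congr rfl fun d hd => ?_
      rw [Finset.mem_powerset] at hd
      rw [hn (Z \ d), coeff_tinv]
      have hcard : (Z \ d).card + d.card = Z.card := by
        rw [Finset.card_sdiff_of_subset hd]
        have := Finset.card_le_card hd
        omega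
      by_cases hsub : d ⊆ L a
      · rw [if_pos hsub, if_pos hsub, ← hcard, pow_add]
        ring
      · rw [if_neg hsub, if_neg hsub]
        simp
    · intro hZ
      have hB : S.biUnion L ⊆ Z := by
        rw [hZ, Finset.biUnion_insert]; exact Finset.subset_union_right
      have hmem : Z \ S.biUnion L ∈ Z.powerset := Finset.mem_powerset.mpr Finset.sdiff_subset
      have hterm : 1 ≤ (if Z \ S.biUnion L ⊆ L a then (Z \ S.biUnion L).card.factorial else 0) *
          n (Z \ (Z \ S.biUnion L)) := by
        rw [if_pos, Finset.sdiff_sdiff_eq_self hB]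
        · exact le_trans (hn1 _ rfl) (Nat.le_mul_of_pos_left _ (Nat.factorial_pos _))
        · rw [hZ, Finset.biUnion_insert]
          intro x hx
          rw [Finset.mem_sdiff, Finset.mem_union] at hx
          rcases hx.1 with h1 | h1
          · exact h1
          · exact absurd h1 hx.2
      exact hterm.trans (Finset.single_le_sum (f := fun d =>
        (if d ⊆ L a then d.card.factorial else 0) * n (Z \ d)) (fun _ _ => Nat.zero_le _) hmem)

/-! ## 2. The `x`-diagonal design: rows are `B⁰ · ∏_{a ∈ u} t_{L a}` -/

/-- **Row formula for the `x`-diagonal indicator design.**  If `x_a` occurs exactly in the form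
`φ_{L a}` (`κ_a(V) = [V = L a]`) for the variables `a` of a thin row `u` (`|u| ≤ 2`, labels in `𝒟`
and distinct inside `u`), then on squarefree monomials the row `u` of the partition matrix of
`∏_{V ∈ 𝒟} φ_V` is the `y`-product `B⁰ = ∏_{V∈𝒟} φ⁰_V` times the truncated inverses of the labels:
`coeff (E u W) ∏_𝒟 φ = coeff (E ∅ W) (B⁰ · ∏_{a ∈ u} t_{L a})`. -/
theorem coeff_xdiag_row (DD : Finset (Finset (Fin h))) (κ : Fin h → Finset (Fin h) → ℂ)
    (L : Fin h → Finset (Fin h)) (u : Finset (Fin h)) (hu : u.card ≤ 2)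
    (hL : ∀ a ∈ u, L a ∈ DD) (hLinj : ∀ a ∈ u, ∀ b ∈ u, L a = L b → a = b)
    (hκ : ∀ a ∈ u, ∀ V ∈ DD, κ a V = if V = L a then 1 else 0) (W : Finset (Fin h)) :
    coeff (∑ a ∈ u, Finsupp.single (Fin.castAdd h a) 1 + ∑ c ∈ W, Finsupp.single (Fin.natAdd h c) 1)
        (∏ V ∈ DD, (C 1 + ∑ a, C (κ a V) * X (Fin.castAdd h a) +
          ∑ c, C (if c ∈ V then (1 : ℂ) else 0) * X (Fin.natAdd h c))) =
      coeff (∑ a ∈ (∅ : Finset (Fin h)), Finsupp.single (Fin.castAdd h a) 1 +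
          ∑ c ∈ W, Finsupp.single (Fin.natAdd h c) 1)
        ((∏ V' ∈ DD, (C 1 + ∑ a, C ((fun (_ : Fin h) (_ : Finset (Fin h)) => (0 : ℂ)) a V') *
            X (Fin.castAdd h a) + ∑ c, C (if c ∈ V' then (1 : ℂ) else 0) * X (Fin.natAdd h c))) *
          ∏ a ∈ u, ∑ U ∈ (L a).powerset, monomial (∑ a' ∈ (∅ : Finset (Fin h)),
            Finsupp.single (Fin.castAdd h a') 1 + ∑ c ∈ U, Finsupp.single (Fin.natAdd h c) 1)
            ((-1 : ℂ) ^ U.card * (U.card.factorial : ℂ))) := by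
  classical
  -- the three cases `|u| = 0, 1, 2`
  rcases Nat.lt_or_ge u.card 1 with h0 | h1
  · -- `u = ∅`
    have hu0 : u = ∅ := Finset.card_eq_zero.mp (by omega)
    subst hu0
    rw [Finset.prod_empty, mul_one, coeff_empty_prod_eq κ (fun _ _ => (0 : ℂ)) DD W]
  rcases Nat.lt_or_ge u.card 2 with h1' | h2
  · -- `u = {a}`
    obtain ⟨a, rfl⟩ := Finset.card_eq_one.mp (show u.card = 1 by omega)
    have haD : L a ∈ DD := hL a (Finset.mem_singleton_self a)
    rw [coeff_single_prod κ DD a W]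
    have hsum : ∀ V ∈ DD, κ a V *
        coeff (∑ a' ∈ (∅ : Finset (Fin h)), Finsupp.single (Fin.castAdd h a') 1 +
            ∑ c ∈ W, Finsupp.single (Fin.natAdd h c) 1)
          (∏ V' ∈ DD.erase V, (C 1 + ∑ a, C (κ a V') * X (Fin.castAdd h a) +
            ∑ c, C (if c ∈ V' then (1 : ℂ) else 0) * X (Fin.natAdd h c))) =
        if V = L a then coeff (∑ a' ∈ (∅ : Finset (Fin h)), Finsupp.single (Fin.castAdd h a') 1 +
            ∑ c ∈ W, Finsupp.single (Fin.natAdd h c) 1)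
          (∏ V' ∈ DD.erase V, (C 1 + ∑ a, C (κ a V') * X (Fin.castAdd h a) +
            ∑ c, C (if c ∈ V' then (1 : ℂ) else 0) * X (Fin.natAdd h c))) else 0 := by
      intro V hV
      rw [hκ a (Finset.mem_singleton_self a) V hV]
      split_ifs <;> simp
    rw [Finset.sum_congr rfl hsum, Finset.sum_ite_eq' DD (L a), if_pos haD,
      coeff_empty_prod_eq κ (fun _ _ => (0 : ℂ)) (DD.erase (L a)) W,
      coeff_leaveOneOut DD (L a) haD W, Finset.prod_singleton,
      coeff_partitionExpo_mul_yOnly _ _ (yOnly_tinv (L a)) ∅ W]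
  · -- `u = {a, b}`
    obtain ⟨a, b, hab, rfl⟩ := Finset.card_eq_two.mp (show u.card = 2 by omega)
    have ha : a ∈ ({a, b} : Finset (Fin h)) := by simp
    have hb : b ∈ ({a, b} : Finset (Fin h)) := by simp
    have haD : L a ∈ DD := hL a ha
    have hbD : L b ∈ DD := hL b hb
    have hLab : L a ≠ L b := fun e => hab (hLinj a ha b hb e)
    have hbD' : L b ∈ DD.erase (L a) := Finset.mem_erase.mpr ⟨Ne.symm hLab, hbD⟩
    rw [coeff_pair_prod κ DD hab W]
    have hsum : ∀ V ∈ DD, κ a V *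
        coeff (∑ a' ∈ ({b} : Finset (Fin h)), Finsupp.single (Fin.castAdd h a') 1 +
            ∑ c ∈ W, Finsupp.single (Fin.natAdd h c) 1)
          (∏ V' ∈ DD.erase V, (C 1 + ∑ a, C (κ a V') * X (Fin.castAdd h a) +
            ∑ c, C (if c ∈ V' then (1 : ℂ) else 0) * X (Fin.natAdd h c))) =
        if V = L a then coeff (∑ a' ∈ ({b} : Finset (Fin h)), Finsupp.single (Fin.castAdd h a') 1 +
            ∑ c ∈ W, Finsupp.single (Fin.natAdd h c) 1)
          (∏ V' ∈ DD.erase V, (C 1 + ∑ a, C (κ a V') * X (Fin.castAdd h a) +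
            ∑ c, C (if c ∈ V' then (1 : ℂ) else 0) * X (Fin.natAdd h c))) else 0 := by
      intro V hV
      rw [hκ a ha V hV]
      split_ifs <;> simp
    rw [Finset.sum_congr rfl hsum, Finset.sum_ite_eq' DD (L a), if_pos haD,
      coeff_single_prod κ (DD.erase (L a)) b W]
    have hsum' : ∀ V ∈ DD.erase (L a), κ b V *
        coeff (∑ a' ∈ (∅ : Finset (Fin h)), Finsupp.single (Fin.castAdd h a') 1 +
            ∑ c ∈ W, Finsupp.single (Fin.natAdd h c) 1)
          (∏ V' ∈ (DD.erase (L a)).erase V, (C 1 + ∑ a, C (κ a V') * X (Fin.castAdd h a) +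
            ∑ c, C (if c ∈ V' then (1 : ℂ) else 0) * X (Fin.natAdd h c))) =
        if V = L b then coeff (∑ a' ∈ (∅ : Finset (Fin h)), Finsupp.single (Fin.castAdd h a') 1 +
            ∑ c ∈ W, Finsupp.single (Fin.natAdd h c) 1)
          (∏ V' ∈ (DD.erase (L a)).erase V, (C 1 + ∑ a, C (κ a V') * X (Fin.castAdd h a) +
            ∑ c, C (if c ∈ V' then (1 : ℂ) else 0) * X (Fin.natAdd h c))) else 0 := by
      intro V hV
      rw [hκ b hb V (Finset.mem_of_mem_erase hV)]
      split_ifs <;> simp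
    rw [Finset.sum_congr rfl hsum', Finset.sum_ite_eq' (DD.erase (L a)) (L b), if_pos hbD',
      coeff_empty_prod_eq κ (fun _ _ => (0 : ℂ)) ((DD.erase (L a)).erase (L b)) W,
      coeff_leaveOneOut (DD.erase (L a)) (L b) hbD' W]
    -- the right-hand side: `(B⁰ · t_{L a}) · t_{L b}`
    rw [Finset.prod_pair hab, ← mul_assoc,
      coeff_partitionExpo_mul_yOnly _ _ (yOnly_tinv (L b)) ∅ W]
    refine Finset.sum_congr rfl fun U _ => ?_
    rw [coeff_leaveOneOut DD (L a) haD (W \ U),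
      coeff_partitionExpo_mul_yOnly _ _ (yOnly_tinv (L a)) ∅ (W \ U)]

end Summit.ValiantsHypothesis.ValiantsHypothesis.Theorems.BarrierLever.ChowSubcube
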